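import Summits.BirchSwinnertonDyer.BirchSwinnertonDyer.Theorems.PrintX8VerticalStevensBridgeEll
import Summits.BirchSwinnertonDyer.BirchSwinnertonDyer.Theorems.ConjSpanGenAllLevels
import Literature.NumberTheory.Automorphic.CongruenceSubgroupPropertySL2AwayHolds
import HarnessLib

/-!
# Route `ByReductionTypeAtTwo` (K4), TOWER road / shared μ₂-supply target — the Stevens `ℓ`-Hecke bridge
# made UNIFORM IN `p` (so that it holds at `p = 2`): span mod `p` by a test set `S` up to Eisenstein +
# `a_ℓ(f) ≢ ℓ + 1 (mod p)` for ONE prime `ℓ ∤ N` ⟹ some `γ ∈ S` has `2·([γ·0]⁺_f − [0]⁺_f)` a `p`-adic UNIT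

Cell `bsd-2adic`, seat `bsd-2adic-tower-1` (GEN 24), `--supports stmt-BirchSwinnertonDyer-19271` (helper; the
first brick of the kernel road «analytic `μ = 0` at `2` on {good ordinary at `2`, `E[2]` irreducible}», which
discharges the certificate binder `hμan : AnalyticMuLE W 2 0` of the TOWER doors and is the planner's shared
supply target RC-250 for 19573 / 19577 / `F1Sign2.AnalyticMuZeroAtTwo`).  Theorems only; no definition, no
named fact, no `sorry`.

## What and why

`PrintX8VerticalStevensBridgeEll.exists_mem_one_le_norm_sub_of_spanModBy_of_prime` (cell `bsd-print-x8`, seat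
p1 g4) proves, for an ODD prime `p`: a rational normalised newform `f ∈ S₂(Γ₀(N))`, a prime `ℓ ∤ N` with
`a_ℓ(f) ≢ ℓ + 1 (mod p)` and a test set `S ⊆ Γ₀(N)` with `SpanModBy N p S` give some `γ = (a b; c d) ∈ S` with
`1 ≤ ‖[b/d]⁺_f − [0]⁺_f‖_p`.  Its proof shows more, uniformly in `p`: the INTEGER `m(γ)` with
`[b/d]⁺_f − [0]⁺_f = m(γ)/2` (`re{∞, γ∞}_f = m(γ)·Ω⁺_f/2`) is prime to `p`; the hypothesis `p ≠ 2` enters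
only when `p ∤ m` is decoded as `1 ≤ ‖m/2‖_p` (`dvd_of_norm_div_two_lt_one`).  At `p = 2` that decoding is
wrong by one factor of `2` (`‖m/2‖₂ = 2‖m‖₂`), and the right currency is `2·([b/d]⁺ − [0]⁺) = m` itself:
this file re-runs the SAME proof (verbatim, adapted from `PrintX8VerticalStevensBridgeEll`, credit there and
to bsd-f3-mu MEMO-an §13.3) with the conclusion

  `∃ γ ∈ S, 1 ≤ ‖(2·([b/d]⁺_f − [0]⁺_f) : ℚ_p)‖`     (`exists_mem_one_le_norm_two_mul_sub_of_spanModBy_of_prime`)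

for EVERY prime `p` (for odd `p` it is equivalent to the tree's statement, `‖2‖_p = 1`).  At `p = 2` it says:
some test element has `[b/d]⁺_f − [0]⁺_f ∈ ½ + ℤ` — the «odd winding class» / «half-integral 2-power cusp» of
the 19573 card `horocycle-span-mod-two` and the 19577 card `odd-winding-class-at-two` (planner RC-250: one
mechanism; stubs S1 + S2 of PEN-PICK-19573 ADD-2 are this theorem once `S` = the `2`-good elements and the span
hypothesis is THEOREM B `ConjSpanGenAllLevels.conjSpanGenAll_of_vaserstein_away` +
`SL2Rel.Away.relG_le_relE_span_natCast` (= `PrintX8VSConjSpanGenAll.conjSpanGen_holds`, imported route-free), see `exists_one_le_norm_two_mul_sub_two_of_odd`).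

HONEST FRAMING: nothing about any curve is asserted here; beyond-print: no (the bridge is bsd-print-x8's; this
is its `p`-uniform restatement).  BSD is not proved by any of this.

References: [Manin1972] Prop. 1.4, Thm. 1.6; [MazurTateTeitelbaum1986Invent] §I.4 (4.2), §I.8; [Stevens1989] §4.
-/

-- the summit namespace repeats `BirchSwinnertonDyer` by design (summit = problem); linter moot
set_option linter.dupNamespace false
set_option autoImplicit false

noncomputable section

namespace Summit.BirchSwinnertonDyer.BirchSwinnertonDyer.Theorems.AnalyticMuTwo

open scoped MatrixGroups ModularForm

open CongruenceSubgroup Matrix Matrix.SpecialLinearGroup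
  Literature.NumberTheory.EllipticCurves Literature.NumberTheory.EllipticCurves.ModularForms
  Literature.NumberTheory.EllipticCurves.Rank1Residual
  Summit.BirchSwinnertonDyer.BirchSwinnertonDyer.Theorems.PrintX8VerticalStevens

section GenericBridge

variable {N : ℕ} [NeZero N] {f : CuspForm (Gamma0 N) 2} {p : ℕ} [Fact p.Prime]

/-- **THE GENERIC BRIDGE with an arbitrary Hecke prime, uniform in `p` (valid at `p = 2`).**  For a
normalised rational newform `f ∈ S₂(Γ₀(N))`, ANY prime `p`, a prime `ℓ ∤ N` with `a_ℓ(f) ≢ ℓ + 1 (mod p)`, and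
ANY test set `S ⊆ Γ₀(N)` with `SpanModBy N p S` (`Γ₁(N) ⊆ ⟨S ∪ finite-order ∪ trace ±2 ∪ p-th powers⟩·[Γ₀,Γ₀]`),
some `γ = (a b; c d) ∈ S` has `1 ≤ ‖2·([b/d]⁺_f − [0]⁺_f)‖_p`, i.e. the integer `m(γ) = 2([b/d]⁺ − [0]⁺)`
(`re{∞,γ∞}_f = m(γ)Ω⁺_f/2`) is prime to `p`.  Proof = `exists_mem_one_le_norm_sub_of_spanModBy_of_prime`
verbatim (the reduced period functional `m̄ : Γ₀(N) → ℤ/p` kills `S`, torsion, trace `±2`, `p`-th powers and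
commutators, hence `Γ₁(N)`; the `ℓ + 1` Hecke terms at `γ∞` give `a_ℓ·m̄ = (ℓ+1)·m̄`, so `m̄ = 0`, contradicting
the primitivity of the periods), except that «`‖2·(m/2)‖_p < 1 ⟹ p ∣ m`» needs no parity of `p`.
Adapted from `Theorems/PrintX8VerticalStevensBridgeEll.lean` (bsd-print-x8 p1 g4).
[cite: Manin1972, Prop. 1.4] [cite: MazurTateTeitelbaum1986Invent, §I.4 (4.2)] -/
theorem exists_mem_one_le_norm_two_mul_sub_of_spanModBy_of_prime (hf : IsNewform0 f)
    (hQ : coeffField f = ⊥) {ℓ : ℕ} [Fact ℓ.Prime] (hℓN : ¬ ℓ ∣ N) {aℓ : ℤ} (haℓ : cuspCoeff f ℓ = aℓ)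
    (haℓ1 : ¬ (p : ℤ) ∣ aℓ - (ℓ + 1)) (S : Set (Gamma0 N)) (hS : SpanModBy N p S) :
    ∃ γ ∈ S, 1 ≤ ‖(((2 : ℚ) * (ratPlusSymbol f ((((γ : SL(2, ℤ)) 0 1 : ℤ) : ℚ) /
        (((γ : SL(2, ℤ)) 1 1 : ℤ) : ℚ)) - ratPlusSymbol f 0) : ℚ) : ℚ_[p])‖ := by
  have hp : p.Prime := Fact.out
  have hreal : ∀ n, (cuspCoeff f n).im = 0 := cuspCoeff_im_eq_zero_of_coeffField_eq_bot hQ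
  have hrat : ∀ r : ℚ, (ratPlusSymbol f r : ℝ) = normalizedPlusSymbol f r :=
    fun r ↦ ratCast_ratPlusSymbol_holds hf hQ r
  have hΩpos : 0 < plusPeriod f := (plusPeriod_pos_and_realPeriods_eq isZLattice_periodLattice_holds hf hQ).1
  have hΩ : plusPeriod f ≠ 0 := hΩpos.ne'
  have hΩ2 : plusPeriod f / 2 ≠ 0 := div_ne_zero hΩ two_ne_zero
  obtain ⟨hre, -⟩ := realPeriods_eq_zmultiples_of_plusPeriod_ne_zero f hΩ
  -- the integer-valued period functional `m`: `re{∞, γ∞} = m(γ)·Ω⁺/2`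
  choose m hm using exists_re_cuspSymbol_eq f hre
  have hm_zero : ∀ γ, cuspSymbol f γ = 0 → m γ = 0 := by
    intro γ h0
    have h := hm γ
    rw [h0, Complex.zero_re] at h
    exact_mod_cast (mul_eq_zero.mp h.symm).resolve_right hΩ2
  have hm_mul : ∀ γ δ, m (γ * δ) = m γ + m δ := by
    intro γ δ
    have h2 : (cuspSymbol f (γ * δ)).re = (cuspSymbol f γ).re + (cuspSymbol f δ).re := by
      rw [cuspSymbol_mul_holds f γ δ, Complex.add_re]
    rw [hm, hm, hm, ← add_mul] at h2
    exact_mod_cast mul_right_cancel₀ hΩ2 h2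
  have hm_one : m 1 = 0 := hm_zero 1 (cuspSymbol_one f)
  have hm_inv : ∀ γ, m γ⁻¹ = -m γ := by
    intro γ
    have h := hm_mul γ γ⁻¹
    rw [mul_inv_cancel, hm_one] at h
    linarith
  have hm_pow : ∀ (γ : Gamma0 N) (n : ℕ), m (γ ^ n) = n * m γ := by
    intro γ n
    induction n with
    | zero => simp [hm_one]
    | succ n ih => rw [pow_succ, hm_mul, ih]; push_cast; ring
  -- symbol identities, in `ℚ`
  have hsub : ∀ (γ : Gamma0 N) (r : ℚ),
      ((γ : SL(2, ℤ)) 1 0 : ℚ) * r + ((γ : SL(2, ℤ)) 1 1 : ℚ) ≠ 0 →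
      ratPlusSymbol f
          ((((γ : SL(2, ℤ)) 0 0 : ℚ) * r + ((γ : SL(2, ℤ)) 0 1 : ℚ)) /
            (((γ : SL(2, ℤ)) 1 0 : ℚ) * r + ((γ : SL(2, ℤ)) 1 1 : ℚ))) -
        ratPlusSymbol f r = (m γ : ℚ) / 2 := by
    intro γ r hr
    have h := ratCast_ratPlusSymbol_moebius_sub f hrat hreal γ r hr
    rw [hm] at h
    have h' : (((ratPlusSymbol f
          ((((γ : SL(2, ℤ)) 0 0 : ℚ) * r + ((γ : SL(2, ℤ)) 0 1 : ℚ)) /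
            (((γ : SL(2, ℤ)) 1 0 : ℚ) * r + ((γ : SL(2, ℤ)) 1 1 : ℚ))) -
        ratPlusSymbol f r : ℚ)) : ℝ) = (((m γ : ℚ) / 2 : ℚ) : ℝ) := by
      push_cast
      rw [h]
      field_simp
    exact_mod_cast h'
  have hinf : ∀ γ : Gamma0 N, ((γ : SL(2, ℤ)) 1 0 : ℤ) ≠ 0 →
      ratPlusSymbol f (((γ : SL(2, ℤ)) 0 0 : ℚ) / ((γ : SL(2, ℤ)) 1 0 : ℚ)) = (m γ : ℚ) / 2 := by
    intro γ hc
    have h := ratCast_ratPlusSymbol_apply_infty f hrat hreal γ hc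
    rw [hm] at h
    have h' : ((ratPlusSymbol f (((γ : SL(2, ℤ)) 0 0 : ℚ) / ((γ : SL(2, ℤ)) 1 0 : ℚ)) : ℚ) : ℝ) =
        (((m γ : ℚ) / 2 : ℚ) : ℝ) := by
      rw [h]; push_cast; field_simp
    exact_mod_cast h'
  -- reduction mod `p` as a homomorphism to `ℤ/p` (written multiplicatively)
  let φ : Gamma0 N →* Multiplicative (ZMod p) :=
    { toFun := fun γ ↦ Multiplicative.ofAdd (((m γ : ℤ) : ZMod p))
      map_one' := by simp [hm_one]
      map_mul' := fun γ δ ↦ by simp [hm_mul, ofAdd_add] }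
  have hφ : ∀ γ, φ γ = 1 ↔ (p : ℤ) ∣ m γ := by
    intro γ
    simp [φ, ZMod.intCast_zmod_eq_zero_iff_dvd]
  -- suppose, for contradiction, that every test element has `‖2·([γ·0]⁺ − [0]⁺)‖ < 1`
  by_contra H
  push Not at H
  -- (1) the test subgroup lies in the kernel
  have hker : Subgroup.closure (S ∪ trivialGens N ∪ pthPowers N p) ⊔ commutator (Gamma0 N) ≤ φ.ker := by
    refine sup_le ?_ (Abelianization.commutator_subset_ker φ)
    rw [Subgroup.closure_le]
    rintro γ ((hγ | htriv) | ⟨h, rfl⟩)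
    · -- test elements: `2·([γ·0]⁺ − [0]⁺) = m(γ)` has norm `< 1`, or `d = 0` (degenerate)
      rw [SetLike.mem_coe, MonoidHom.mem_ker, hφ]
      by_cases hd : ((γ : SL(2, ℤ)) 1 1 : ℤ) = 0
      · exact ⟨0, by rw [hm_zero γ (cuspSymbol_eq_zero_of_apply_one_one_eq_zero f γ hd), mul_zero]⟩
      · have hd0 : ((γ : SL(2, ℤ)) 1 1 : ℚ) ≠ 0 := by exact_mod_cast hd
        have h0 := hsub γ 0 (by simpa using hd0)
        simp only [mul_zero, zero_add] at h0
        have hlt := H γ hγ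
        rw [h0] at hlt
        have hcast : ((((2 : ℚ) * ((m γ : ℚ) / 2) : ℚ)) : ℚ_[p]) = ((m γ : ℤ) : ℚ_[p]) := by
          push_cast; ring
        rw [hcast, Padic.norm_intCast_lt_one_iff] at hlt
        exact hlt
    · rw [SetLike.mem_coe, MonoidHom.mem_ker, hφ]
      rcases htriv with hfin | htr | htr
      · exact ⟨0, by rw [hm_zero γ (cuspSymbol_eq_zero_of_isOfFinOrder f hfin), mul_zero]⟩
      · exact ⟨0, by rw [hm_zero γ (cuspSymbol_eq_zero_of_trEntry f (Or.inl htr)), mul_zero]⟩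
      · exact ⟨0, by rw [hm_zero γ (cuspSymbol_eq_zero_of_trEntry f (Or.inr htr)), mul_zero]⟩
    · -- `p`-th powers
      rw [SetLike.mem_coe, MonoidHom.mem_ker, hφ, hm_pow]
      exact ⟨m h, by ring⟩
  -- (2) hence `m̄` vanishes on `Γ₁(N)` and is constant on `Γ₁(N)`-cosets
  have hΓ₁ : ∀ γ : Gamma0 N, γ ∈ Gamma1' N → ((m γ : ℤ) : ZMod p) = 0 := fun γ hγ ↦
    (ZMod.intCast_zmod_eq_zero_iff_dvd _ _).mpr ((hφ γ).mp (hker (hS γ hγ)))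
  have hcoset : ∀ γ δ : Gamma0 N, δ * γ⁻¹ ∈ Gamma1' N →
      ((m δ : ℤ) : ZMod p) = ((m γ : ℤ) : ZMod p) := by
    intro γ δ h
    have h1 := hΓ₁ _ h
    rw [hm_mul, hm_inv, ← sub_eq_add_neg, Int.cast_sub, sub_eq_zero] at h1
    exact h1
  -- two ratio elements with `d ≡ ℓ` and `d ≡ ℓ^{φ(N)-1}` have cancelling `m̄`-contributions
  have hℓ : ℓ.Prime := Fact.out
  have hpair : ∀ γ δ δ' : Gamma0 N, Gamma0Map N (δ * γ⁻¹) = (ℓ : ZMod N) →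
      Gamma0Map N (δ' * γ⁻¹) = (ℓ : ZMod N) ^ (Nat.totient N - 1) →
      ((m δ : ℤ) : ZMod p) + ((m δ' : ℤ) : ZMod p) = 2 * ((m γ : ℤ) : ZMod p) := by
    intro γ δ δ' hδ hδ'
    -- `(δγ⁻¹)(δ'γ⁻¹) ∈ Γ₁(N)` since `ℓ · ℓ^{φ−1} = 1`
    have hprod : δ * γ⁻¹ * (δ' * γ⁻¹) ∈ Gamma1' N := by
      rw [Gamma1_mem', map_mul, hδ, hδ', mul_comm, pow_totient_sub_one_mul_self (N := N) (p := ℓ) hℓN]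
    have h1 := hΓ₁ _ hprod
    rw [hm_mul, hm_mul, hm_mul, hm_inv] at h1
    push_cast at h1
    linear_combination h1
  -- (3) the Hecke step: `m̄ ≡ 0` on all of `Γ₀(N)`
  have haℓ1' : ((aℓ - (ℓ + 1) : ℤ) : ZMod p) ≠ 0 := by
    rwa [ne_eq, ZMod.intCast_zmod_eq_zero_iff_dvd]
  have hall : ∀ γ : Gamma0 N, (p : ℤ) ∣ m γ := by
    intro γ
    by_cases hc : ((γ : SL(2, ℤ)) 1 0 : ℤ) = 0
    · have h0 : cuspSymbol f γ = 0 := by simp [cuspSymbol, hc]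
      rw [hm_zero γ h0]; exact dvd_zero _
    · have hHecke := intCast_mul_ratPlusSymbol ℓ hf hℓ hℓN haℓ hrat
        (((γ : SL(2, ℤ)) 0 0 : ℚ) / ((γ : SL(2, ℤ)) 1 0 : ℚ))
      have hterm := fun j : Fin ℓ ↦ exists_heckeTerm_gamma1 (N := N) (p := ℓ) γ hc ((j : ℕ) : ℤ)
      choose δ hδ0 hδq hδ1 hδp using hterm
      obtain ⟨δ', hδ'0, hδ'q, hδ'1, hδ'p⟩ := exists_heckeTerm'_gamma1 (N := N) (p := ℓ) hℓN γ hc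
      have hcQ : (((γ : SL(2, ℤ)) 1 0 : ℤ) : ℚ) ≠ 0 := by exact_mod_cast hc
      have hpQ : (ℓ : ℚ) ≠ 0 := by exact_mod_cast hℓ.ne_zero
      have e0 := hinf γ hc
      have ej : ∀ j : Fin ℓ,
          ratPlusSymbol f ((((γ : SL(2, ℤ)) 0 0 : ℚ) / ((γ : SL(2, ℤ)) 1 0 : ℚ) + j) / ℓ) =
            (m (δ j) : ℚ) / 2 := by
        intro j
        rw [← hinf (δ j) (hδ0 j), hδq j]
        congr 1
        push_cast
        field_simp
      have e' : ratPlusSymbol f (ℓ * ((((γ : SL(2, ℤ)) 0 0 : ℚ) / ((γ : SL(2, ℤ)) 1 0 : ℚ)))) =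
          (m δ' : ℚ) / 2 := by
        rw [← hinf δ' hδ'0, hδ'q]
      rw [e0, e'] at hHecke
      simp_rw [ej] at hHecke
      -- `aℓ · m γ = Σ m(δ j) + m δ'` in `ℤ`
      have hZ : ((aℓ * m γ : ℤ) : ℚ) = ((∑ j : Fin ℓ, m (δ j) + m δ' : ℤ) : ℚ) := by
        push_cast
        have := hHecke
        rw [← Finset.sum_div] at this
        linear_combination 2 * this
      have hZ' : aℓ * m γ = ∑ j : Fin ℓ, m (δ j) + m δ' := by exact_mod_cast hZ
      have hmod : ((aℓ : ℤ) : ZMod p) * ((m γ : ℤ) : ZMod p) =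
          ∑ j : Fin ℓ, ((m (δ j) : ℤ) : ZMod p) + ((m δ' : ℤ) : ZMod p) := by
        have := congrArg (Int.cast : ℤ → ZMod p) hZ'
        push_cast at this
        exact this
      -- the sum of the `ℓ + 1` reduced terms is `(ℓ + 1)·m̄(γ)`
      have hsum : ∑ j : Fin ℓ, ((m (δ j) : ℤ) : ZMod p) + ((m δ' : ℤ) : ZMod p) =
          ((ℓ + 1 : ℤ) : ZMod p) * ((m γ : ℤ) : ZMod p) := by
        -- notation
        have hdet : ((γ : SL(2, ℤ)) 0 0 : ℤ) * ((γ : SL(2, ℤ)) 1 1 : ℤ) -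
            ((γ : SL(2, ℤ)) 0 1 : ℤ) * ((γ : SL(2, ℤ)) 1 0 : ℤ) = 1 := by
          have := Matrix.SpecialLinearGroup.det_coe (γ : SL(2, ℤ))
          rw [Matrix.det_fin_two] at this
          linear_combination this
        have hℓZ : Prime (ℓ : ℤ) := Nat.prime_iff_prime_int.mp hℓ
        -- every term congruent to `m̄ γ` sums to `ℓ • m̄ γ` over `Fin ℓ`
        have hconst : ∑ _j : Fin ℓ, ((m γ : ℤ) : ZMod p) = ((ℓ : ℤ) : ZMod p) * ((m γ : ℤ) : ZMod p) := by
          rw [Finset.sum_const, Finset.card_univ, Fintype.card_fin, nsmul_eq_mul]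
          push_cast; ring
        by_cases hpc : (ℓ : ℤ) ∣ ((γ : SL(2, ℤ)) 1 0 : ℤ)
        · -- all `ℓ + 1` ratio elements lie in `Γ₁(N)`
          have hpa : ¬ (ℓ : ℤ) ∣ ((γ : SL(2, ℤ)) 0 0 : ℤ) := by
            intro hpa
            have : (ℓ : ℤ) ∣ 1 := by
              rw [← hdet]
              exact dvd_sub (hpa.mul_right _) (hpc.mul_left _)
            exact hℓZ.not_dvd_one this
          have hgen : ∀ j : Fin ℓ,
              ¬ (ℓ : ℤ) ∣ ((γ : SL(2, ℤ)) 0 0 : ℤ) + ((j : ℕ) : ℤ) * ((γ : SL(2, ℤ)) 1 0 : ℤ) := by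
            intro j hdiv
            have h := dvd_sub hdiv (hpc.mul_left ((j : ℕ) : ℤ))
            rw [add_sub_cancel_right] at h
            exact hpa h
          have hj : ∀ j : Fin ℓ, ((m (δ j) : ℤ) : ZMod p) = ((m γ : ℤ) : ZMod p) :=
            fun j ↦ hcoset γ (δ j) (hδ1 j (hgen j))
          have h' : ((m δ' : ℤ) : ZMod p) = ((m γ : ℤ) : ZMod p) := hcoset γ δ' (hδ'1 hpc)
          simp_rw [hj, h', hconst]
          push_cast; ring
        · -- exactly one special index `j₀` (with `ℓ ∣ a + j₀ c`); it pairs with the `ℓa/c` term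
          have hcp : ((((γ : SL(2, ℤ)) 1 0 : ℤ)) : ZMod ℓ) ≠ 0 := by
            rwa [ne_eq, ZMod.intCast_zmod_eq_zero_iff_dvd]
          set z : ZMod ℓ := -((((γ : SL(2, ℤ)) 0 0 : ℤ)) : ZMod ℓ) * ((((γ : SL(2, ℤ)) 1 0 : ℤ)) : ZMod ℓ)⁻¹
            with hz
          set j₀ : Fin ℓ := ⟨z.val, z.val_lt⟩ with hj₀
          have hj₀z : (((j₀ : ℕ) : ℤ) : ZMod ℓ) = z := by
            rw [hj₀]; push_cast; exact ZMod.natCast_zmod_val z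
          -- characterisation of the special index
          have hspec : ∀ j : Fin ℓ,
              (ℓ : ℤ) ∣ ((γ : SL(2, ℤ)) 0 0 : ℤ) + ((j : ℕ) : ℤ) * ((γ : SL(2, ℤ)) 1 0 : ℤ) ↔ j = j₀ := by
            intro j
            rw [← ZMod.intCast_zmod_eq_zero_iff_dvd]
            push_cast
            constructor
            · intro h
              have hjz : ((j : ℕ) : ZMod ℓ) = z := by
                rw [hz, eq_mul_inv_iff_mul_eq₀ hcp]
                linear_combination h
              have hj₀z' : ((j₀ : ℕ) : ZMod ℓ) = z := by exact_mod_cast hj₀z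
              apply Fin.ext
              have h1 : ((j : ℕ) : ZMod ℓ) = ((j₀ : ℕ) : ZMod ℓ) := hjz.trans hj₀z'.symm
              have h2 := congrArg ZMod.val h1
              rwa [ZMod.val_natCast, ZMod.val_natCast, Nat.mod_eq_of_lt j.isLt,
                Nat.mod_eq_of_lt j₀.isLt] at h2
            · rintro rfl
              have : (((j₀ : ℕ) : ℤ) : ZMod ℓ) = z := hj₀z
              push_cast at this
              rw [this, hz]
              field_simp
              ring
          have hj : ∀ j : Fin ℓ, j ≠ j₀ → ((m (δ j) : ℤ) : ZMod p) = ((m γ : ℤ) : ZMod p) :=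
            fun j hne ↦ hcoset γ (δ j) (hδ1 j (fun h ↦ hne ((hspec j).mp h)))
          have hj₀p : Gamma0Map N (δ j₀ * γ⁻¹) = (ℓ : ZMod N) := hδp j₀ ((hspec j₀).mpr rfl)
          have hpair' := hpair γ (δ j₀) δ' hj₀p (hδ'p hpc)
          -- split the sum at `j₀`
          have hsplit : ∑ j : Fin ℓ, ((m (δ j) : ℤ) : ZMod p) =
              ∑ _j : Fin ℓ, ((m γ : ℤ) : ZMod p) +
                (((m (δ j₀) : ℤ) : ZMod p) - ((m γ : ℤ) : ZMod p)) := by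
            have h1 : ∑ j : Fin ℓ, ((m (δ j) : ℤ) : ZMod p) =
                ∑ j : Fin ℓ, (((m γ : ℤ) : ZMod p) + (((m (δ j) : ℤ) : ZMod p) - ((m γ : ℤ) : ZMod p))) :=
              Finset.sum_congr rfl fun j _ ↦ by ring
            have h2 : ∑ j : Fin ℓ, (((m (δ j) : ℤ) : ZMod p) - ((m γ : ℤ) : ZMod p)) =
                ((m (δ j₀) : ℤ) : ZMod p) - ((m γ : ℤ) : ZMod p) :=
              Finset.sum_eq_single_of_mem j₀ (Finset.mem_univ _)
                fun j _ hne ↦ by rw [hj j hne, sub_self]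
            rw [h1, Finset.sum_add_distrib, h2]
          rw [hsplit, hconst]
          push_cast
          linear_combination hpair'
      rw [hsum] at hmod
      have hzero : ((aℓ - (ℓ + 1) : ℤ) : ZMod p) * ((m γ : ℤ) : ZMod p) = 0 := by
        push_cast at hmod ⊢; linear_combination hmod
      rw [← ZMod.intCast_zmod_eq_zero_iff_dvd]
      exact (mul_eq_zero.mp hzero).resolve_left haℓ1'
  -- (4) contradiction with the primitivity of the period functional
  exact not_forall_dvd_of_realPeriods f hre hΩ hp.one_lt hm hall

end GenericBridge

/-! ### The bridge at `p = 2` on the `2`-good elements, span statement discharged by THEOREM B -/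

section Two

variable {N : ℕ} [NeZero N] {f : CuspForm (Gamma0 N) 2}

/-- **THE BRIDGE AT `p = 2`, span discharged (stubs S1 + S2 of the merged 19573/19577 μ₂-line).**  For a
normalised rational newform `f ∈ S₂(Γ₀(N))` of ODD level `N` and ONE odd prime `ℓ ∤ N` with `a_ℓ(f)` ODD:
there are `k ≥ 0` and `b ∈ ℤ` with `1 ≤ ‖2·([b/2ᵏ]⁺_f − [0]⁺_f)‖₂`, i.e. `[b/2ᵏ]⁺_f − [0]⁺_f ∈ ½ + ℤ` — a
2-power cusp with a HALF-INTEGRAL winding class.  Ingredients: THEOREM B `conjSpanGen_holds` at `(N, 2)`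
(tree, unconditional, here through the route-free pair `conjSpanGenAll_of_vaserstein_away` +
`SL2Rel.Away.relG_le_relE_span_natCast`: `Γ_H(N) ⊆ ⟨2-good, torsion, trace ±2⟩·[Γ₀,Γ₀]`) ⇒ `EisSpanModGen N 2`
(`eisSpanModGen_of_conjSpanGen`) ⇒ `SpanModBy N 2 {2-good}` (`spanModBy_setOf_isGoodAt_iff`), then
`exists_mem_one_le_norm_two_mul_sub_of_spanModBy_of_prime` at `p = 2` (`a_ℓ ≢ ℓ + 1 (mod 2)` iff `a_ℓ` odd,
`ℓ` odd); the good element `γ = (a b; c ±2ᵏ)` gives the cusp `b/±2ᵏ`.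
[cite: Manin1972, Prop. 1.4] [cite: MazurTateTeitelbaum1986Invent, §I.4 (4.2)] -/
theorem exists_one_le_norm_two_mul_sub_two_of_odd (hf : IsNewform0 f) (hQ : coeffField f = ⊥)
    (h2N : ¬ 2 ∣ N) {ℓ : ℕ} [Fact ℓ.Prime] (hℓN : ¬ ℓ ∣ N) {aℓ : ℤ} (haℓ : cuspCoeff f ℓ = aℓ)
    (haℓ1 : ¬ (2 : ℤ) ∣ aℓ - (ℓ + 1)) :
    ∃ (k : ℕ) (b : ℤ), 1 ≤ ‖(((2 : ℚ) * (ratPlusSymbol f ((b : ℚ) / (2 : ℚ) ^ k) -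
      ratPlusSymbol f 0) : ℚ) : ℚ_[2])‖ := by
  haveI : Fact (Nat.Prime 2) := ⟨Nat.prime_two⟩
  -- THEOREM B (tree, unconditional): the orbit trick in `Γ₀(N; ℤ[1/2])` + Vaserstein's relative theorem
  have hB : ConjSpanGen N 2 :=
    ConjSpanGenAllLevels.conjSpanGenAll_of_vaserstein_away
      Literature.NumberTheory.Automorphic.SL2Rel.Away.relG_le_relE_span_natCast N 2 Nat.prime_two h2N
  have hspan : EisSpanModGen N 2 := eisSpanModGen_of_conjSpanGen hB
  obtain ⟨γ, ⟨k, hk⟩, hunit⟩ := exists_mem_one_le_norm_two_mul_sub_of_spanModBy_of_prime (p := 2) hf hQ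
    hℓN haℓ (by exact_mod_cast haℓ1) {γ : Gamma0 N | IsGoodAt 2 γ}
    ((spanModBy_setOf_isGoodAt_iff N 2).mpr hspan)
  have hd : ((γ : SL(2, ℤ)) 1 1 : ℤ) = (2 : ℤ) ^ k ∨ ((γ : SL(2, ℤ)) 1 1 : ℤ) = -((2 : ℤ) ^ k) := by
    have := Int.natAbs_eq_iff.mp hk
    push_cast at this
    simpa [dEntry] using this
  rcases hd with hd | hd
  · refine ⟨k, ((γ : SL(2, ℤ)) 0 1 : ℤ), ?_⟩
    have e : (((γ : SL(2, ℤ)) 0 1 : ℤ) : ℚ) / (2 : ℚ) ^ k =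
        (((γ : SL(2, ℤ)) 0 1 : ℤ) : ℚ) / (((γ : SL(2, ℤ)) 1 1 : ℤ) : ℚ) := by
      rw [hd]; push_cast; rfl
    rw [e]
    exact hunit
  · refine ⟨k, -((γ : SL(2, ℤ)) 0 1 : ℤ), ?_⟩
    have e : (((-((γ : SL(2, ℤ)) 0 1 : ℤ) : ℤ)) : ℚ) / (2 : ℚ) ^ k =
        (((γ : SL(2, ℤ)) 0 1 : ℤ) : ℚ) / (((γ : SL(2, ℤ)) 1 1 : ℤ) : ℚ) := by
      rw [hd]; push_cast; rw [div_neg, neg_div]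
    rw [e]
    exact hunit

end Two

end Summit.BirchSwinnertonDyer.BirchSwinnertonDyer.Theorems.AnalyticMuTwo

end
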